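/-
Copyright (c) 2026. Released under the Apache 2.0 license.
-/
import Literature.NumberTheory.EllipticCurves.ManinConstantQuadraticTwist
import Literature.NumberTheory.EllipticCurves.QuadraticTwistMinimalModelProofs
import Literature.NumberTheory.EllipticCurves.QuadraticTwistKroneckerLFunctionProofs
import Literature.NumberTheory.EllipticCurves.SzpiroLocalDataProofs
import Literature.NumberTheory.EllipticCurves.RootNumberTwistProofs
import Literature.NumberTheory.EllipticCurves.EichlerShimuraConstructionProofs
import HarnessLib

/-!
# Stevens 1989, Lemma (5.2) at an odd prime conductor — discharge of the named fact
# `stevens1989_neronLattice_quadraticTwist_oddPrime`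

[Proofs] Theorems only (no definition, no named fact). Topic `Literature/NumberTheory/EllipticCurves`.

The named fact `Literature.NumberTheory.EllipticCurves.ModularForms.stevens1989_neronLattice_quadraticTwist_oddPrime`
(`ManinConstantQuadraticTwist.lean`; G. Stevens, *Stickelberger elements and modular
parametrizations of elliptic curves*, Invent. Math. 98 (1989), Lemma (5.2) p. 96, for the quadratic
character of odd prime conductor `q`: "`ℒ(A^ψ) = (η/τ(ψ)) ℒ(A)`" with `η = 1`) says: for a globally
minimal `W/ℚ` with good or multiplicative reduction at the odd prime `q`, Néron-type pair `L`, every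
globally minimal model `C` of the twist `W ⊗ χ_{q*}` (`C = v • W.quadraticTwist q*`,
`q* = (−1)^{(q−1)/2} q`) with Néron-type pair `L'`, and every `s` with `s² = q*`:
`z ∈ Λ(C) ↔ s z ∈ Λ(W)`, i.e. `Λ(C) = s⁻¹ Λ(W)`.

Stevens' "Sketch of Proof" (p. 96): "`τ(ψ)⁻¹ ω_A` is a regular differential on `A^ψ` over `ℚ` …
[the relation of minimal discriminants] reduces the calculation of `η` to an application of Tate's
algorithm." Here, in the tree's vocabulary (Tate's algorithm replaced by Silverman's valuation
criteria for minimality, *AEC* VII.1 Remark 1.1):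

1. `isNeronLatticeOf_twistModel` — the INTEGRAL twist model `T = W.twistModel k`, `4k + 1 = d`
   (`QuadraticTwistIntegralModel.lean`: `c₄(T) = d² c₄(W)`, `c₆(T) = d³ c₆(W)`) has the Néron-type
   pair `s⁻¹ L` for any `s² = d` (`g₂(s⁻¹Λ) = s⁴ g₂(Λ)`, `g₃(s⁻¹Λ) = s⁶ g₃(Λ)`; Pal 2012 Lemma 3.1
   "`ω(E^d) = ω(E)/√d`").
2. `isGloballyMinimal_twistModel_pStar` — for `d = q*` (so `k = (q* − 1)/4 ∈ ℤ`) and `W` globally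
   minimal with good or multiplicative reduction at `q`, `T` is GLOBALLY MINIMAL: at `v ≠ q` the
   twisting parameter is a `v`-unit and minimality is preserved
   (`WeierstrassCurve.isMinimalAt_twistModel`, Comalada 1994 §2); at `v = q`, `ord_q Δ(T) = 6 < 12`
   if `W` is good at `q`, and `ord_q c₄(T) = 2 < 4` if `W` is multiplicative at `q`
   (Silverman *AEC* VII.1 Remark 1.1, VII.5 Prop. 5.1; tree `isMinimalAt_of_lt_valuation_Δ_holds`,
   `isMinimalAt_of_lt_valuation_c₄`).
3. `stevens1989_neronLattice_quadraticTwist_oddPrime_holds` — any globally minimal `C ≅ W ⊗ χ_{q*}`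
   is `w • T` with `w.u = ±1` (uniqueness of the global minimal model, Silverman *AEC* VII.1.3(b),
   VIII.8.3: `WeierstrassCurve.isGloballyMinimal_unique_holds`), so its Néron lattice is that of
   `T`, namely `s⁻¹ Λ(W)` (`IsNeronLatticeOf.lattice_eq_mulLeft_of_smul`, uniqueness of the lattice
   with given invariants `IsNeronLatticeOf.lattice_eq`).

So the fact is now a THEOREM (D-0026 discharge; its users `not_dvd_maninConstant₀_of_twist_of_stevens`
and `not_dvd_maninConstant_of_twist_gamma0_of_stevens` may be fed `…_holds`).

## References
* [Stevens1989] G. Stevens, op. cit., Lemma (5.2) p. 96 (statement and "Sketch of Proof").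
* [Pal2012] V. Pal, *Periods of quadratic twists of elliptic curves*, Proc. AMS 140 (2012),
  Remark 2.3, Prop. 2.4/2.5, Lemma 3.1.
* [SilvermanAEC2009] J. H. Silverman, *The Arithmetic of Elliptic Curves*, 2nd ed., VII.1
  Remark 1.1 and Prop. 1.3(b), VII.5 Prop. 5.1, VIII.8.3, X.5 Cor. 5.4.
* S. Comalada, *Twists and reduction of an elliptic curve*, J. Number Theory 49 (1994), §2.
-/

noncomputable section

open scoped MatrixGroups ModularForm Classical

open CongruenceSubgroup WeierstrassCurve IsDedekindDomain IsDedekindDomain.HeightOneSpectrum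
  NumberField Rat.HeightOneSpectrum

namespace Literature.NumberTheory.EllipticCurves.ModularForms

/-! ### 1. The Néron-type pair of the integral twist model -/

/-- **`Λ(W.twistModel k) = s⁻¹ Λ(W)` for `s² = 4k + 1`**, as Néron-type period pairs over `ℂ`:
`c₄ ↦ d² c₄`, `c₆ ↦ d³ c₆` under the twist model by `d = 4k + 1` (`twistModel_c₄`, `twistModel_c₆`)
and `g₂(s⁻¹ Λ) = s⁴ g₂(Λ)`, `g₃(s⁻¹ Λ) = s⁶ g₃(Λ)` (`PeriodPair.g₂_mulLeft`, `g₃_mulLeft`).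
Pal 2012, Lemma 3.1 with Remark 2.3. [cite: Pal2012, Lemma 3.1 and Remark 2.3] -/
theorem isNeronLatticeOf_twistModel {W : WeierstrassCurve ℚ} (k : ℚ) {L : PeriodPair}
    (hL : IsNeronLatticeOf (W.baseChange ℂ) L) {s : ℂ} (hs0 : s ≠ 0)
    (hs : s ^ 2 = ((4 * k + 1 : ℚ) : ℂ)) :
    IsNeronLatticeOf ((W.twistModel k).baseChange ℂ) (L.mulLeft s⁻¹ (inv_ne_zero hs0)) := by
  have hT : (W.twistModel k).baseChange ℂ = (W.baseChange ℂ).twistModel ((k : ℚ) : ℂ) := by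
    simp only [WeierstrassCurve.baseChange, map_twistModel, eq_ratCast]
  have hd : (4 * ((k : ℚ) : ℂ) + 1) = s ^ 2 := by rw [hs]; push_cast; ring
  constructor
  · rw [PeriodPair.g₂_mulLeft, hL.1, hT, twistModel_c₄, hd, inv_pow, inv_inv]
    ring
  · rw [PeriodPair.g₃_mulLeft, hL.2, hT, twistModel_c₆, hd, inv_pow, inv_inv]
    ring

/-! ### 2. The integral twist model by `q*` of a globally minimal curve semistable at `q` is globally minimal -/

section Minimal

variable (W : WeierstrassCurve ℚ) [W.IsElliptic] [W.IsGloballyMinimal] {q : ℕ} [Fact q.Prime]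

/-- `q* = (−1)^{(q−1)/2} q` as an integer, and the twisting parameter `k = (q* − 1)/4`:
`4k + 1 = q*`. [folklore] -/
private theorem four_mul_kStar_add_one (hq2 : q ≠ 2) :
    4 * (((-1 : ℤ) ^ (q / 2) * q - 1) / 4) + 1 = (-1 : ℤ) ^ (q / 2) * q := by
  have h4 := four_dvd_pStar_sub_one (p := q) hq2
  have := Int.ediv_mul_cancel h4
  linarith [this]

/-- `q ∥ q*`. [folklore] -/
private theorem dvd_pStar_and_not_sq_dvd :
    ((q : ℕ) : ℤ) ∣ (-1 : ℤ) ^ (q / 2) * q ∧ ¬ ((q : ℕ) : ℤ) ^ 2 ∣ (-1 : ℤ) ^ (q / 2) * q := by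
  have hq : q.Prime := Fact.out
  have hqZ : Prime ((q : ℕ) : ℤ) := Nat.prime_iff_prime_int.mp hq
  refine ⟨Dvd.intro_left _ rfl, fun h ↦ ?_⟩
  have hu : IsUnit ((-1 : ℤ) ^ (q / 2)) := (isUnit_neg_one (α := ℤ)).pow _
  have h' : ((q : ℕ) : ℤ) ^ 2 ∣ (q : ℤ) := (hu.dvd_mul_left).mp h
  have h1 : ((q : ℤ) : ℤ) * q ∣ (q : ℤ) * 1 := by simpa [sq] using h'
  have hq0 : (q : ℤ) ≠ 0 := by exact_mod_cast hq.ne_zero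
  have h2 : (q : ℤ) ∣ 1 := (mul_dvd_mul_iff_left hq0).mp h1
  exact hq.one_lt.ne' (by exact_mod_cast Int.eq_one_of_dvd_one (by positivity) h2)

/-- **The integral twist model by `q*` of a globally minimal `W` with good or multiplicative
reduction at the odd prime `q` is globally minimal** (`k = (q* − 1)/4`, `4k + 1 = q*`). At a place
`v ≠ q`: `q*` is a `v`-unit, `k ∈ ℤ`, and `WeierstrassCurve.isMinimalAt_twistModel` (Silverman
*AEC* VII.1 Prop. 1.3; Comalada 1994 §2). At `v = q`: the twist model is `v`-integral (integer
coefficients), and `Δ ↦ q*⁶ Δ`, `c₄ ↦ q*² c₄`; if `W` is good at `q` then `ord_q Δ(W) = 0`, so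
`ord_q Δ = 6 < 12`; if `W` is multiplicative at `q` then `ord_q c₄(W) = 0`, so `ord_q c₄ = 2 < 4`;
either way the equation is minimal at `q` (Silverman *AEC* VII.1 Remark 1.1). This is the
"application of Tate's algorithm" of Stevens' sketch of proof of Lemma (5.2) (`η = 1` at odd `q`).
[cite: SilvermanAEC2009, VII.1 Remark 1.1 and Prop. 1.3, VII.5 Prop. 5.1]
[cite: Stevens1989, Lemma (5.2) p. 96 (sketch of proof)] -/
theorem isGloballyMinimal_twistModel_pStar (hq2 : q ≠ 2)
    (hsemi : W.HasGoodReductionAtPrime q ∨ W.HasMultiplicativeReductionAtPrime q) :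
    (W.twistModel (((((-1 : ℤ) ^ (q / 2) * q - 1) / 4 : ℤ) : ℚ))).IsGloballyMinimal := by
  have hq : q.Prime := Fact.out
  set d : ℤ := (-1 : ℤ) ^ (q / 2) * q with hd
  set k : ℤ := (d - 1) / 4 with hk
  have h4k : (4 : ℤ) * k + 1 = d := four_mul_kStar_add_one hq2
  have h4kℚ : (4 : ℚ) * (k : ℚ) + 1 = (d : ℚ) := by exact_mod_cast h4k
  -- integrality over `𝓞 ℚ`
  have hkO : algebraMap (𝓞 ℚ) ℚ ((k : ℤ) : 𝓞 ℚ) = (k : ℚ) := by simp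
  have hint : IsIntegral (𝓞 ℚ) (W.twistModel (k : ℚ)) := by
    have := isIntegral_twistModel (𝓞 ℚ) W ((k : ℤ) : 𝓞 ℚ)
    rwa [hkO] at this
  -- the integer model and the valuations of the coefficients of the twist model
  set M : WeierstrassCurve ℤ := integralModelInt W with hM
  have hWM : M.map (Int.castRingHom ℚ) = W := map_integralModelInt W
  have hTM : (M.twistModel k).map (Int.castRingHom ℚ) = W.twistModel (k : ℚ) := by
    rw [map_twistModel, hWM, eq_intCast]
  have hintv : ∀ v : HeightOneSpectrum (𝓞 ℚ), (W.twistModel (k : ℚ)).IsIntegralAt v := by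
    intro v
    refine (W.twistModel (k : ℚ)).isIntegralAt_of_valuation_le_one v ?_ ?_ ?_ ?_ ?_
    · rw [← hTM, map_a₁, eq_intCast]; exact valuation_ringOfIntegers_intCast_le_one v _
    · rw [← hTM, map_a₂, eq_intCast]; exact valuation_ringOfIntegers_intCast_le_one v _
    · rw [← hTM, map_a₃, eq_intCast]; exact valuation_ringOfIntegers_intCast_le_one v _
    · rw [← hTM, map_a₄, eq_intCast]; exact valuation_ringOfIntegers_intCast_le_one v _
    · rw [← hTM, map_a₆, eq_intCast]; exact valuation_ringOfIntegers_intCast_le_one v _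
  refine ⟨hint, fun v ↦ ?_⟩
  have hpP : (primesEquiv v : ℕ).Prime := (primesEquiv v).2
  by_cases hvq : (primesEquiv v : ℕ) = q
  · -- the ramified place `v = q`
    have hvd : v.valuation ℚ (d : ℚ) = WithZero.exp (-1 : ℤ) := by
      obtain ⟨h1, h2⟩ := dvd_pStar_and_not_sq_dvd (q := q)
      exact valuation_ringOfIntegers_intCast_eq_exp_neg_one v (by rw [hvq]; exact h1)
        (by rw [hvq]; exact h2)
    have hv4k : v.valuation ℚ (4 * (k : ℚ) + 1) = WithZero.exp (-1 : ℤ) := by rw [h4kℚ, hvd]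
    haveI := Fact.mk hpP
    rcases hsemi with hgood | hmult
    · -- good reduction at `q`: `ord_q Δ(T) = 6`
      have hgood' : W.HasGoodReductionAt v := by
        have h := W.hasGoodReductionAtPrime_iff_hasGoodReductionAt_ringOfIntegers v
        have hq' : (primesEquiv v) = ⟨q, hq⟩ := Subtype.ext hvq
        rw [hq'] at h
        exact h.mp hgood
      have hvΔ : v.valuation ℚ W.Δ = 1 :=
        (hasGoodReductionAt_iff_of_isMinimalAt (v := v) (W := W)
          (IsGloballyMinimal.isMinimal v)).mp hgood'
      have hΔ : v.valuation ℚ (W.twistModel (k : ℚ)).Δ = WithZero.exp (-6 : ℤ) := by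
        rw [twistModel_Δ, map_mul, map_pow, hv4k, hvΔ, mul_one, ← WithZero.exp_nsmul]
        norm_num
      exact isMinimalAt_of_lt_valuation_Δ_holds (hintv v)
        (by rw [hΔ]; exact WithZero.exp_lt_exp.mpr (by norm_num))
    · -- multiplicative reduction at `q`: `ord_q c₄(T) = 2`
      have hmult' : W.HasMultiplicativeReductionAt v := by
        have h := W.hasMultiplicativeReductionAtPrime_iff_hasMultiplicativeReductionAt_ringOfIntegers v
        have hq' : (primesEquiv v) = ⟨q, hq⟩ := Subtype.ext hvq
        rw [hq'] at h
        exact h.mp hmult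
      have hvc₄ : v.valuation ℚ W.c₄ = 1 :=
        ((hasMultiplicativeReductionAt_iff_of_isMinimalAt (v := v) (W := W)
          (IsGloballyMinimal.isMinimal v)).mp hmult').2
      have hc₄ : v.valuation ℚ (W.twistModel (k : ℚ)).c₄ = WithZero.exp (-2 : ℤ) := by
        rw [twistModel_c₄, map_mul, map_pow, hv4k, hvc₄, mul_one, ← WithZero.exp_nsmul]
        norm_num
      exact isMinimalAt_of_lt_valuation_c₄ (hintv v)
        (by rw [hc₄]; exact WithZero.exp_lt_exp.mpr (by norm_num))
  · -- an unramified place `v ≠ q`: `q*` is a `v`-unit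
    have hnd : ¬ ((primesEquiv v : ℕ) : ℤ) ∣ d := by
      intro h
      have hu : IsUnit ((-1 : ℤ) ^ (q / 2)) := (isUnit_neg_one (α := ℤ)).pow _
      have h' : ((primesEquiv v : ℕ) : ℤ) ∣ (q : ℤ) := (hu.dvd_mul_left).mp h
      exact hvq ((Nat.prime_dvd_prime_iff_eq hpP hq).mp (Int.natCast_dvd_natCast.mp h'))
    have hvd : v.valuation ℚ (d : ℚ) = 1 := valuation_ringOfIntegers_intCast_eq_one v hnd
    have hv4k : v.valuation ℚ (4 * (k : ℚ) + 1) = 1 := by rw [h4kℚ, hvd]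
    exact isMinimalAt_twistModel v W (IsGloballyMinimal.isMinimal v)
      (valuation_ringOfIntegers_intCast_le_one v k) hv4k

end Minimal

/-! ### 3. The discharge -/

/-- **Stevens 1989, Lemma (5.2) at an odd prime conductor, PROVED** (discharge of the named fact
`stevens1989_neronLattice_quadraticTwist_oddPrime`): for `W/ℚ` globally minimal with good or
multiplicative reduction at the odd prime `q`, Néron pair `L`, any globally minimal `C` with
`C = v • W.quadraticTwist q*`, Néron pair `L'`, and `s² = q*`: `z ∈ Λ(C) ↔ s z ∈ Λ(W)`. Proof: the
integral twist model `T = W.twistModel ((q*−1)/4)` is globally minimal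
(`isGloballyMinimal_twistModel_pStar`) with Néron pair `s⁻¹ L` (`isNeronLatticeOf_twistModel`);
`C = w • T` (completing the square, `exists_variableChange_twistModel_eq_quadraticTwist`) with
`w.u = ±1` (`WeierstrassCurve.isGloballyMinimal_unique_holds`), so `Λ(C) = w.u · s⁻¹ Λ(W) = s⁻¹ Λ(W)`
(`IsNeronLatticeOf.lattice_eq_mulLeft_of_smul`). [cite: Stevens1989, Lemma (5.2) p. 96]
[cite: SilvermanAEC2009, VII.1 Prop. 1.3(b) and VIII.8.3] [cite: Pal2012, Lemma 3.1] -/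
theorem stevens1989_neronLattice_quadraticTwist_oddPrime_holds :
    stevens1989_neronLattice_quadraticTwist_oddPrime := by
  intro W _ _ L hL q _ hq2 hsemi C _ _ hCtw L' hL' s hs z
  have hq : q.Prime := Fact.out
  set d : ℤ := (-1 : ℤ) ^ (q / 2) * q with hd
  set k : ℤ := (d - 1) / 4 with hk
  have h4k : (4 : ℤ) * k + 1 = d := four_mul_kStar_add_one hq2
  have h4kℚ : (4 : ℚ) * (k : ℚ) + 1 = (d : ℚ) := by exact_mod_cast h4k
  have hdZ : d ≠ 0 := by
    rw [hd]
    exact mul_ne_zero (pow_ne_zero _ (by norm_num)) (by exact_mod_cast hq.ne_zero)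
  have hd0 : (d : ℚ) ≠ 0 := by exact_mod_cast hdZ
  have hs0 : s ≠ 0 := by
    rintro rfl
    have h0 : ((d : ℤ) : ℂ) = 0 := by rw [← hs]; simp
    exact hdZ (by exact_mod_cast h0)
  -- the integral twist model `T`, globally minimal, with Néron pair `s⁻¹ L`
  set T : WeierstrassCurve ℚ := W.twistModel (k : ℚ) with hT
  haveI hTmin : T.IsGloballyMinimal := isGloballyMinimal_twistModel_pStar W hq2 hsemi
  have hLT : IsNeronLatticeOf (T.baseChange ℂ) (L.mulLeft s⁻¹ (inv_ne_zero hs0)) :=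
    isNeronLatticeOf_twistModel (k : ℚ) hL hs0 (by rw [hs, h4kℚ]; push_cast; rfl)
  -- `C = w • T`
  obtain ⟨v, hv⟩ := hCtw
  obtain ⟨C₀, -, hC₀⟩ := exists_variableChange_twistModel_eq_quadraticTwist W (k : ℚ)
  rw [h4kℚ] at hC₀
  have hCw : C = (v * C₀) • T := by rw [mul_smul, hT, hC₀, hv]
  haveI : T.IsElliptic := by
    haveI : (W.quadraticTwist (d : ℚ)).IsElliptic := W.isElliptic_quadraticTwist hd0
    have h : T = C₀⁻¹ • W.quadraticTwist (d : ℚ) := by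
      rw [← hC₀, ← mul_smul, inv_mul_cancel, one_smul]
    rw [h]; infer_instance
  haveI : ((v * C₀) • T).IsGloballyMinimal := by rw [← hCw]; infer_instance
  -- `u = ±1`
  have hu : (v * C₀).u = 1 ∨ (v * C₀).u = -1 := (isGloballyMinimal_unique_holds T (v * C₀)).1
  -- `Λ(C) = u · s⁻¹ Λ(W)`
  have hL'T : IsNeronLatticeOf (((v * C₀) • T).baseChange ℂ) L' := by rw [← hCw]; exact hL'
  have hΛ := IsNeronLatticeOf.lattice_eq_mulLeft_of_smul (v * C₀) hLT hL'T
  rw [hΛ, PeriodPair.mem_mulLeft_lattice, PeriodPair.mem_mulLeft_lattice, inv_inv, ← mul_assoc]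
  rcases hu with h1 | h1
  · rw [h1]; simp
  · rw [h1]
    simp only [Units.val_neg, Units.val_one, Rat.cast_neg, Rat.cast_one, inv_neg, inv_one,
      mul_neg, mul_one, neg_mul]
    exact neg_mem_iff

end Literature.NumberTheory.EllipticCurves.ModularForms

end
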